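import Literature.AlgebraicGeometry.Resolution.ValuationDefect
import Mathlib.RingTheory.IntegralClosure.IntegrallyClosed
import Mathlib.RingTheory.Valuation.LocalSubring
import HarnessLib

/-!
# Trivially valued fields are defectless (Kuhlmann 2010, §1) — proofs for `ValuationDefect.lean`

Topic: `Literature/AlgebraicGeometry/Resolution` (valued function fields). PROVED companion of
`ValuationDefect.lean`: the base case of the named fact `Kuhlmann2010Stability` vendored there,
F.-V. Kuhlmann, *Elimination of ramification I: The generalized stability theorem*, Trans. AMS 362
(2010) = arXiv:1003.5678, §1, p. 3: "Note that every trivially valued field is a defectless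
field" — which is also why Temkin 2013, Remark 2.1.3 ("if `k` is stable then `l` is stable")
applies to the trivially valued ground field of Thm. 1.3.2. It doubles as a non-vacuity check of
the definitions `ramificationIndex`, `inertiaDegree`, `IsDefectlessIn`, `IsDefectlessField`.

## Content (everything PROVED)

* `valuationSubring_eq_top_of_comap_eq_top` — over an algebraic extension `L/K` the only
  valuation ring of `L` lying over the trivial valuation ring `K` of `K` is `L` (valuation rings
  are integrally closed); `eq_of_le_of_comap_eq` — for `L/K` finite, distinct extensions of a
  valuation ring of `K` to `L` are incomparable (from the finiteness of `e`).
* `one_le_ramificationIndex_and_inertiaDegree` — `e, f ≥ 1` for `L/K` finite;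
  `ramificationIndex_top`, `inertiaDegree_top` — for the trivial valuation ring of `L`:
  `e_{L/K} = 1` (the value group is trivial) and `f_{L/K} = [L : K]` (the residue fields are the
  fields themselves).
* `isDefectlessIn_top`, `isDefectlessField_top` — hence `(K, K)` (trivial valuation) is
  defectless in every finite extension: a defectless (stable) valued field.

## Sources

* F.-V. Kuhlmann, Trans. AMS 362 (2010) = arXiv:1003.5678, §1 (p. 3).
* M. Temkin, J. Algebra 373 (2013) = arXiv:0804.1554v3, §2.1 (p. 9), Remark 2.1.3 (p. 10).
-/

noncomputable section

namespace Literature.AlgebraicGeometry.Resolution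

open IsLocalRing

universe u

variable (K : Type u) [Field K] {L : Type u} [Field L] [Algebra K L]

/-- Over an ALGEBRAIC extension `L/K`, a valuation ring of `L` containing (the image of) `K` is
all of `L`: it is integrally closed and `L` is integral over `K`. [folklore] -/
theorem valuationSubring_eq_top_of_comap_eq_top [Algebra.IsAlgebraic K L] (O' : ValuationSubring L)
    (h : O'.comap (algebraMap K L) = ⊤) : O' = ⊤ := by
  have hK : ∀ c : K, algebraMap K L c ∈ O' := fun c => by
    have hc : c ∈ O'.comap (algebraMap K L) := by
      rw [h]
      exact ValuationSubring.mem_top c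
    exact hc
  letI : Algebra K O' := ((algebraMap K L).codRestrict O'.toSubring hK).toAlgebra
  haveI : IsScalarTower K O' L := IsScalarTower.of_algebraMap_eq fun _ => rfl
  ext x
  refine ⟨fun _ => ValuationSubring.mem_top x, fun _ => ?_⟩
  have hx : IsIntegral K x := (Algebra.IsAlgebraic.isAlgebraic (R := K) x).isIntegral
  have hx' : IsIntegral O' x := hx.tower_top
  obtain ⟨y, rfl⟩ := IsIntegrallyClosed.algebraMap_eq_of_integral hx'
  exact y.2

/-- **Distinct extensions of a valuation to a finite extension are incomparable**: if `L/K` is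
finite and `O₁ ⊆ O₂` are valuation rings of `L` inducing the same valuation ring of `K`, then
`O₁ = O₂`. PROVED, from the finiteness of `e` (`ramificationIndex_mul_inertiaDegree_le_finrank`):
for `x ∈ O₂ ∖ O₁` some power `x^m` (`m ≤ e`) has the value of an element `c ∈ K`, and then
`c = (c/x^m)·x^m ∈ O₂ ∩ K = K°` while `|c|₁ = |x|₁^m > 1`, i.e. `c ∉ O₁ ∩ K = K°`. [folklore] -/
theorem eq_of_le_of_comap_eq [FiniteDimensional K L] (O₁ O₂ : ValuationSubring L) (hle : O₁ ≤ O₂)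
    (h : O₁.comap (algebraMap K L) = O₂.comap (algebraMap K L)) : O₁ = O₂ := by
  refine le_antisymm hle fun x hx₂ => ?_
  by_contra hx₁
  have hx0 : x ≠ 0 := fun h0 => hx₁ (by rw [h0]; exact zero_mem _)
  have hvx : 1 < O₁.valuation x := lt_of_not_ge fun hle1 => hx₁ ((O₁.valuation_le_one_iff x).mp hle1)
  -- a power of `|x|₁` is the value of an element of `K`
  obtain ⟨hfi, -, -⟩ := ramificationIndex_mul_inertiaDegree_le_finrank K O₁
  haveI := hfi
  obtain ⟨m, hm0, -, hm⟩ := Subgroup.exists_pow_mem_of_index_ne_zero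
    (Subgroup.FiniteIndex.index_ne_zero (H := valueSubgroup K O₁))
    (Units.mk0 (O₁.valuation x) ((Valuation.ne_zero_iff _).mpr hx0))
  obtain ⟨c, hc0, hc⟩ := (mem_valueSubgroup_iff K O₁ _).mp hm
  rw [Units.val_pow_eq_pow_val, Units.val_mk0, ← map_pow] at hc
  -- `c ∈ O₂ ∩ K = K°`
  have hcO₂ : algebraMap K L c ∈ O₂ := by
    have hxm0 : x ^ m ≠ 0 := pow_ne_zero m hx0
    have hw : algebraMap K L c * (x ^ m)⁻¹ ∈ O₁ := by
      refine (O₁.valuation_le_one_iff _).mp (le_of_eq ?_)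
      rw [map_mul, map_inv₀, ← hc, mul_inv_cancel₀ ((Valuation.ne_zero_iff _).mpr hxm0)]
    have heq : algebraMap K L c = algebraMap K L c * (x ^ m)⁻¹ * x ^ m := by
      rw [inv_mul_cancel_right₀ hxm0]
    rw [heq]
    exact mul_mem (hle hw) (pow_mem hx₂ m)
  have hcO : c ∈ O₂.comap (algebraMap K L) := hcO₂
  -- but `|c|₁ = |x|₁^m > 1`, so `c ∉ O₁ ∩ K = K°`
  rw [← h] at hcO
  have hle1 : O₁.valuation (algebraMap K L c) ≤ 1 := (O₁.valuation_le_one_iff _).mpr hcO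
  rw [← hc, map_pow] at hle1
  exact (one_lt_pow₀ hvx hm0.ne').not_ge hle1

/-- For a finite extension `L/K`, `e ≥ 1` and `f ≥ 1` (the conventions `index = 0`,
`finrank = 0` for the infinite case do not occur). PROVED. [folklore] -/
theorem one_le_ramificationIndex_and_inertiaDegree [FiniteDimensional K L] (O' : ValuationSubring L) :
    1 ≤ ramificationIndex K O' ∧ 1 ≤ inertiaDegree K O' := by
  obtain ⟨hfi, hfin, -⟩ := ramificationIndex_mul_inertiaDegree_le_finrank K O'
  haveI := hfi
  haveI := hfin
  refine ⟨Nat.one_le_iff_ne_zero.mpr (Subgroup.FiniteIndex.index_ne_zero (H := valueSubgroup K O')), ?_⟩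
  unfold inertiaDegree
  exact Module.finrank_pos

/-- **`e = 1` for the trivial valuation**: the value group of the trivial valuation ring `L` of `L`
is trivial, so `|K^×|` has index `1` in it. PROVED. [folklore] -/
theorem ramificationIndex_top : ramificationIndex K (⊤ : ValuationSubring L) = 1 := by
  unfold ramificationIndex
  rw [Subgroup.index_eq_one]
  refine eq_top_iff.mpr fun γ _ => ?_
  rw [units_valueGroup_top_eq_one γ]
  exact one_mem _

/-- The residue field of the trivial valuation ring `L ⊆ L` is `L`: the residue map composed with
`L ≅ (⊤ : ValuationSubring L)` is a ring isomorphism. [folklore] -/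
theorem exists_ringEquiv_residueField_top :
    ∃ j : L ≃+* ResidueField (⊤ : ValuationSubring L),
      ∀ x : L, j x = residue (⊤ : ValuationSubring L) ⟨x, ValuationSubring.mem_top x⟩ := by
  -- `(⊤ : ValuationSubring L) ≃+* L`
  let e₁ : (⊤ : ValuationSubring L) ≃+* L :=
    RingEquiv.ofBijective (⊤ : ValuationSubring L).subtype
      ⟨Subtype.val_injective, fun x => ⟨⟨x, ValuationSubring.mem_top x⟩, rfl⟩⟩
  -- `⊤` is a field, so its residue map is an isomorphism
  have hfield : IsField (⊤ : ValuationSubring L) :=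
    MulEquiv.isField (Field.toIsField L) e₁.toMulEquiv
  have hbot : maximalIdeal (⊤ : ValuationSubring L) = ⊥ :=
    (isField_iff_maximalIdeal_eq).mp hfield
  have hinj : Function.Injective (residue (⊤ : ValuationSubring L)) := by
    rw [injective_iff_map_eq_zero]
    intro a ha
    have hmem : a ∈ maximalIdeal (⊤ : ValuationSubring L) := (residue_eq_zero_iff _).mp ha
    rw [hbot] at hmem
    exact hmem
  let e₂ : (⊤ : ValuationSubring L) ≃+* ResidueField (⊤ : ValuationSubring L) :=
    RingEquiv.ofBijective (residue (⊤ : ValuationSubring L)) ⟨hinj, residue_surjective⟩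
  refine ⟨e₁.symm.trans e₂, fun x => ?_⟩
  have hx : e₁.symm x = ⟨x, ValuationSubring.mem_top x⟩ :=
    e₁.injective (by rw [RingEquiv.apply_symm_apply]; rfl)
  rw [RingEquiv.trans_apply, hx]
  rfl

/-- **`f = [L : K]` for the trivial valuation**: the residue field of the trivial valuation ring
of `L` is `L`, that of `K` is `K`, so the inertia degree is the degree. PROVED. [folklore] -/
theorem inertiaDegree_top : inertiaDegree K (⊤ : ValuationSubring L) = Module.finrank K L := by
  obtain ⟨j, hj⟩ := exists_ringEquiv_residueField_top (L := L)
  -- the residue subfield of `K` is the image of `K`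
  have hmem : ∀ r, r ∈ residueSubfield K (⊤ : ValuationSubring L) ↔ ∃ c : K, j (algebraMap K L c) = r := by
    intro r
    rw [mem_residueSubfield_iff]
    constructor
    · rintro ⟨c, h, rfl⟩
      exact ⟨c, hj _⟩
    · rintro ⟨c, rfl⟩
      exact ⟨c, ValuationSubring.mem_top _, (hj _).symm⟩
  -- `K ≃ residueSubfield K ⊤`, compatibly with `j`
  let f : K →+* residueSubfield K (⊤ : ValuationSubring L) :=
    (j.toRingHom.comp (algebraMap K L)).codRestrict _ fun c => (hmem _).mpr ⟨c, rfl⟩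
  have hf : Function.Bijective f := by
    refine ⟨fun a b hab => ?_, fun r => ?_⟩
    · have h1 : j (algebraMap K L a) = j (algebraMap K L b) := congrArg Subtype.val hab
      exact (algebraMap K L).injective (j.injective h1)
    · obtain ⟨c, hc⟩ := (hmem r).mp r.2
      exact ⟨c, Subtype.ext hc⟩
  let i : K ≃+* residueSubfield K (⊤ : ValuationSubring L) := RingEquiv.ofBijective f hf
  have h := Algebra.finrank_eq_of_equiv_equiv i j (by ext c; rfl)
  unfold inertiaDegree
  exact h.symm

/-- **The trivial valuation is defectless in every finite extension**: over `L/K` finite the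
trivial valuation ring `K` of `K` has exactly one extension to `L`, the trivial valuation ring of
`L`, with `e = 1` and `f = [L : K]`, so `∑ eᵢfᵢ = 1 · [L : K] = [L : K]`. PROVED. [folklore] -/
theorem isDefectlessIn_top [FiniteDimensional K L] : IsDefectlessIn K (⊤ : ValuationSubring K) L := by
  classical
  haveI : Algebra.IsAlgebraic K L := Algebra.IsAlgebraic.of_finite K L
  refine ⟨{⊤}, fun O' => ?_, ?_⟩
  · rw [Finset.mem_singleton]
    constructor
    · rintro rfl
      ext c
      exact ⟨fun _ => ValuationSubring.mem_top c, fun _ => ValuationSubring.mem_top _⟩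
    · exact valuationSubring_eq_top_of_comap_eq_top K O'
  · rw [Finset.sum_singleton, ramificationIndex_top, inertiaDegree_top, one_mul]

/-- **A trivially valued field is defectless (stable)** (Kuhlmann 2010, §1, p. 3: "Note that
every trivially valued field is a defectless field") — the base case in which Temkin 2013 applies
the generalized stability theorem (Remark 2.1.3: "if `k` is stable then `l` is stable", with `k`
the trivially valued ground field of Thm. 1.3.2). PROVED. [cite: Kuhlmann2010, Section 1 (p. 3 of arXiv:1003.5678)] -/
theorem isDefectlessField_top : IsDefectlessField K (⊤ : ValuationSubring K) := by
  intro L _ _ hfin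
  haveI := hfin
  exact isDefectlessIn_top K

end Literature.AlgebraicGeometry.Resolution
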